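import Mathlib
import HarnessLib

/-!
# Von Neumann's alternating projections theorem and its rate of convergence

Source transcribed: F. Deutsch, *Best Approximation in Inner Product Spaces*, CMS Books in
Mathematics 7, Springer (2001), Chapter 9 "The Method of Alternating Projections"
[Deutsch2001] (held; read pp. 193–202 of the printed text: Lemma 9.2, Theorem 9.3 with its
proof, Definition 9.4, Lemma 9.5, Theorem 9.8 with its proof, and the Remarks after 9.3 and
after 9.8).  Theorem 9.3 is von Neumann's theorem (J. von Neumann, *Functional Operators II*,
Annals of Math. Studies 22, Princeton 1950, Thm 13.7; lectures of 1933); the rate in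
Theorem 9.8 goes back to N. Aronszajn, *Theory of reproducing kernels*, Trans. AMS 68 (1950).
We cite Deutsch's numbering throughout.

Setting.  `E` is an inner product space over `𝕜 = ℝ` or `ℂ` (`RCLike 𝕜`); `M₁ M₂ : Submodule 𝕜 E`
admit orthogonal projections (`Submodule.HasOrthogonalProjection`, automatic for complete, in
particular for closed subspaces of a Hilbert space); `Mᵢ.starProjection : E →L[𝕜] E` is
Mathlib's orthogonal projection `P_{Mᵢ}` and `M₁ ⊓ M₂` is `M₁ ∩ M₂`.

* `altProj M₁ M₂ x n = (P_{M₂} ∘ P_{M₁})^[n] x = (P_{M₂} P_{M₁})ⁿ x` (`altProj_eq_pow_apply`), the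
  even-indexed terms `x_{2n}` of Deutsch's alternating sequence (9.3.1); the odd-indexed terms
  are `P_{M₁} (altProj M₁ M₂ x n) = x_{2n+1}`.
* [Deu01, Lemma 9.2 (1) ⇒ (4)] `starProjection_starProjection_eq_of_commute`: commuting
  projections compose to `P_{M₁ ∩ M₂}`.
* [Deu01, Thm 9.3, proof] the ingredients, stated for a starting point `x ∈ M₂` (Deutsch's
  index bookkeeping `n, m ≥ 1` is replaced by this hypothesis; the general case is recovered by
  starting from `x₂ = P_{M₂} P_{M₁} x`): norms decrease (`antitone_norm_altProj`), the
  self-adjointness identities (9.3.4)/(9.3.5) (`inner_altProj_succ_left`,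
  `inner_starProjection_altProj`, `inner_altProj_add_shift`), whence
  `‖x_{2n}‖² ≤ Re ⟪x_{2n}, x_{2m}⟫` and `‖x_{2n} − x_{2m}‖² ≤ ‖x_{2m}‖² − ‖x_{2n}‖²` for `m ≤ n`
  (`norm_altProj_sub_sq_le`), so the sequence is Cauchy (`cauchySeq_altProj_of_mem`);
  `⟪x_{2n}, z⟫ = ⟪x, z⟫` for `z ∈ M₁ ∩ M₂` (`inner_altProj_eq_of_mem`).
* [Deu01, Thm 9.3] (von Neumann) in a Hilbert space, for every `x`,
  `(P_{M₂} P_{M₁})ⁿ x → P_{M₁ ∩ M₂} x` (`tendsto_altProj`, operator-power form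
  `tendsto_pow_starProjection_comp_apply`) and `P_{M₁} (P_{M₂} P_{M₁})ⁿ x → P_{M₁ ∩ M₂} x`
  (`tendsto_starProjection_altProj`), i.e. the whole alternating sequence converges; the
  a-posteriori bound `‖P_{M₁∩M₂} x − x_{2m}‖² ≤ ‖x_{2m}‖² − ‖P_{M₁∩M₂} x‖²` for `x ∈ M₂`
  (`norm_starProjection_sub_altProj_sq_le`).
* [Deu01, Def 9.4] `cosAngle M₁ M₂ = c(M₁, M₂)`, the cosine of the (Friedrichs) angle:
  `sup {‖⟪x, y⟫‖ : x ∈ M₁ ∩ (M₁∩M₂)ᗮ, ‖x‖ ≤ 1, y ∈ M₂ ∩ (M₁∩M₂)ᗮ, ‖y‖ ≤ 1}`;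
  [Deu01, Lemma 9.5 (1), (6)] `0 ≤ c ≤ 1` and `‖⟪x, y⟫‖ ≤ c ‖x‖ ‖y‖` whenever `x ∈ M₁`,
  `y ∈ M₂` and at least one of them is in `(M₁ ∩ M₂)ᗮ` (`norm_inner_le_cosAngle_mul`,
  `norm_inner_le_cosAngle_mul_of_right_mem`, `norm_inner_le_cosAngle_mul_of_left_mem`).
* [Deu01, Thm 9.8, proof] (9.8.2) `P_{Mᵢ}((M₁∩M₂)ᗮ) ⊆ (M₁∩M₂)ᗮ`, (9.8.4)
  `‖P_{M₂} P_{M₁} x‖ ≤ c ‖P_{M₁} x‖` on `(M₁∩M₂)ᗮ`, (9.8.5) `‖P_{M₂} P_{M₁} x‖ ≤ c² ‖x‖` on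
  `M₂ ∩ (M₁∩M₂)ᗮ ⊇ P_{M₂} P_{M₁}((M₁∩M₂)ᗮ)`.
* [Deu01, Thm 9.8] (Aronszajn's rate) for every `x` and `n ≥ 1`,
  `‖(P_{M₂} P_{M₁})ⁿ x − P_{M₁∩M₂} x‖ ≤ c^{2n−1} ‖x − P_{M₁∩M₂} x‖ ≤ c^{2n−1} ‖x‖`
  (`norm_altProj_sub_starProjection_le`, `norm_altProj_sub_starProjection_le'`), stated with
  `n + 1` in place of `n ≥ 1`.  This part is pure inner-product-space algebra and does not use
  completeness of `E`.

Deviations.  (i) We work over `RCLike 𝕜` (Deutsch: real spaces; von Neumann: complex), with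
`Re ⟪·,·⟫` where Deutsch has `⟨·,·⟩`.  (ii) Theorem 9.3 is proved for the two subsequences
`x_{2n}` and `x_{2n+1}` separately rather than for the interleaved sequence `(x_n)`.  (iii) The
hypotheses are the `HasOrthogonalProjection` instances for `M₁`, `M₂`, `M₁ ⊓ M₂` plus
`CompleteSpace E` for Theorem 9.3 (Deutsch: closed subspaces of a Hilbert space; his Remark (1)
after 9.3 notes that completeness of the subspaces is what is used);
`hasOrthogonalProjection_inf` produces the instance for `M₁ ⊓ M₂` from closedness in a Hilbert
space.  (iv) Not formalised: Lemma 9.5 (2)–(5), (7)–(8) (`c = ‖P_{M₂}P_{M₁} − P_{M₁∩M₂}‖`,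
`c = 0 ⇔` the projections commute), Lemma 9.6 / Theorem 9.7 (`c < 1 ⇔ M₁ + M₂` closed), the
sharpness of the rate (Thm 9.31), Dykstra's algorithm and Halperin's `r`-subspace version; the
Remark (3) after 9.8 (failure for two general closed convex sets) is not needed here.

Dedup.  Mathlib has the orthogonal projection API used below (`Submodule.starProjection`,
`inner_starProjection_left_eq_right`, `eq_starProjection_of_mem_of_inner_eq_zero`, …) and von
Neumann's *mean ergodic* theorem, but no alternating-projections theorem; the tree's
`Literature.Analysis.Convex.ConvexMetricProjection` records (module docstring) that Chapter 9 of
[Deutsch2001] was not formalised there.  Proofs are ours, following Deutsch's.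
-/

noncomputable section

open Filter Topology Set Function

namespace Literature.Analysis.Convex.AlternatingProjections

variable {𝕜 : Type*} [RCLike 𝕜] {E : Type*} [NormedAddCommGroup E] [InnerProductSpace 𝕜 E]

open scoped InnerProductSpace

/-! ## The alternating sequence -/

section Defs

variable (M₁ M₂ : Submodule 𝕜 E) [M₁.HasOrthogonalProjection] [M₂.HasOrthogonalProjection]

/-- [cite: Deutsch2001, Ch. 9, (9.3.1)] The even-indexed alternating projections
`x_{2n} = (P_{M₂} P_{M₁})ⁿ x`. -/
def altProj (x : E) (n : ℕ) : E :=
  (M₂.starProjection ∘ M₁.starProjection)^[n] x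

/-- [cite: Deutsch2001, Ch. 9, Def 9.4] The cosine `c(M₁, M₂)` of the angle between `M₁` and
`M₂`: the supremum of `‖⟪x, y⟫‖` over `x ∈ M₁ ∩ (M₁ ∩ M₂)ᗮ`, `y ∈ M₂ ∩ (M₁ ∩ M₂)ᗮ` in the unit
ball. -/
def cosAngle (M₁ M₂ : Submodule 𝕜 E) : ℝ :=
  sSup ((fun p : E × E => ‖⟪p.1, p.2⟫_𝕜‖) ''
    {p : E × E | p.1 ∈ M₁ ∧ p.1 ∈ (M₁ ⊓ M₂)ᗮ ∧ ‖p.1‖ ≤ 1 ∧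
      p.2 ∈ M₂ ∧ p.2 ∈ (M₁ ⊓ M₂)ᗮ ∧ ‖p.2‖ ≤ 1})

end Defs

variable {M₁ M₂ : Submodule 𝕜 E} [M₁.HasOrthogonalProjection] [M₂.HasOrthogonalProjection]

/-- [cite: Deutsch2001, Ch. 9, (9.3.1)] `x_0 = x`. -/
theorem altProj_zero (x : E) : altProj M₁ M₂ x 0 = x := rfl

/-- [cite: Deutsch2001, Ch. 9, (9.3.1)] `x_{2n+2} = P_{M₂} (P_{M₁} x_{2n})`. -/
theorem altProj_succ (x : E) (n : ℕ) :
    altProj M₁ M₂ x (n + 1) = M₂.starProjection (M₁.starProjection (altProj M₁ M₂ x n)) := by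
  rw [altProj, altProj, Function.iterate_succ_apply']
  rfl

/-- [cite: Deutsch2001, Ch. 9, Thm 9.3] `x_{2n} = (P_{M₂} P_{M₁})ⁿ x` as an operator power. -/
theorem altProj_eq_pow_apply (x : E) (n : ℕ) :
    altProj M₁ M₂ x n = ((M₂.starProjection.comp M₁.starProjection) ^ n) x := by
  rw [altProj, ContinuousLinearMap.coe_pow']
  rfl

/-- [cite: Deutsch2001, Ch. 9, Thm 9.3, proof] Restarting the iteration:
`(P₂P₁)^[n] ((P₂P₁) x) = (P₂P₁)^[n+1] x`. -/
theorem altProj_altProj_one (x : E) (n : ℕ) :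
    altProj M₁ M₂ (altProj M₁ M₂ x 1) n = altProj M₁ M₂ x (n + 1) := by
  rw [altProj, altProj, altProj, Function.iterate_one, ← Function.iterate_succ_apply]

/-- [cite: Deutsch2001, Ch. 9, Thm 9.3, proof] `x ↦ x_{2n}` is additive (it is a bounded
linear operator); subtraction form. -/
theorem altProj_sub (x y : E) (n : ℕ) :
    altProj M₁ M₂ (x - y) n = altProj M₁ M₂ x n - altProj M₁ M₂ y n := by
  simp only [altProj_eq_pow_apply, map_sub]

/-- [cite: Deutsch2001, Ch. 9, Thm 9.3, proof] `x_{2n} ∈ M₂` for `n ≥ 1`. -/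
theorem altProj_succ_mem (x : E) (n : ℕ) : altProj M₁ M₂ x (n + 1) ∈ M₂ := by
  rw [altProj_succ]
  exact Submodule.starProjection_apply_mem _ _

/-- [cite: Deutsch2001, Ch. 9, Thm 9.3, proof] If already `x ∈ M₂` then every `x_{2n} ∈ M₂`. -/
theorem altProj_mem_of_mem {x : E} (hx : x ∈ M₂) (n : ℕ) : altProj M₁ M₂ x n ∈ M₂ := by
  cases n with
  | zero => exact hx
  | succ n => exact altProj_succ_mem x n

/-- [cite: Deutsch2001, Ch. 9, Thm 9.3, proof] `x_{2n+1} = P_{M₁} x_{2n} ∈ M₁`. -/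
theorem starProjection_altProj_mem (x : E) (n : ℕ) :
    M₁.starProjection (altProj M₁ M₂ x n) ∈ M₁ :=
  Submodule.starProjection_apply_mem _ _

/-- [cite: Deutsch2001, Ch. 9, Thm 9.3, proof] A point of `M₁ ∩ M₂` is fixed by the
iteration. -/
theorem altProj_eq_self_of_mem {z : E} (hz₁ : z ∈ M₁) (hz₂ : z ∈ M₂) (n : ℕ) :
    altProj M₁ M₂ z n = z := by
  induction n with
  | zero => rfl
  | succ n ih =>
    rw [altProj_succ, ih, Submodule.starProjection_eq_self_iff.2 hz₁,
      Submodule.starProjection_eq_self_iff.2 hz₂]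

/-- [cite: Deutsch2001, Ch. 9, Thm 9.3, proof, (9.3.2)] `‖x_{2n+1}‖ ≤ ‖x_{2n}‖`. -/
theorem norm_starProjection_altProj_le (x : E) (n : ℕ) :
    ‖M₁.starProjection (altProj M₁ M₂ x n)‖ ≤ ‖altProj M₁ M₂ x n‖ :=
  M₁.norm_starProjection_apply_le _

/-- [cite: Deutsch2001, Ch. 9, Thm 9.3, proof, (9.3.2)] `‖x_{2n+2}‖ ≤ ‖x_{2n+1}‖`. -/
theorem norm_altProj_succ_le (x : E) (n : ℕ) :
    ‖altProj M₁ M₂ x (n + 1)‖ ≤ ‖M₁.starProjection (altProj M₁ M₂ x n)‖ := by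
  rw [altProj_succ]
  exact M₂.norm_starProjection_apply_le _

/-- [cite: Deutsch2001, Ch. 9, Thm 9.3, proof, (9.3.2)] `‖x_{2n+2}‖ ≤ ‖x_{2n}‖`. -/
theorem norm_altProj_succ_le_norm_altProj (x : E) (n : ℕ) :
    ‖altProj M₁ M₂ x (n + 1)‖ ≤ ‖altProj M₁ M₂ x n‖ :=
  (norm_altProj_succ_le x n).trans (norm_starProjection_altProj_le x n)

/-- [cite: Deutsch2001, Ch. 9, Thm 9.3, proof, (9.3.2)] `{‖x_{2n}‖}` is decreasing. -/
theorem antitone_norm_altProj (x : E) : Antitone fun n => ‖altProj M₁ M₂ x n‖ :=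
  antitone_nat_of_succ_le fun n => norm_altProj_succ_le_norm_altProj x n

/-- [cite: Deutsch2001, Ch. 9, Thm 9.3, proof, (9.3.2)] `‖x_{2n}‖ ≤ ‖x‖`. -/
theorem norm_altProj_le (x : E) (n : ℕ) : ‖altProj M₁ M₂ x n‖ ≤ ‖x‖ :=
  antitone_norm_altProj x (Nat.zero_le n)

/-- [cite: Deutsch2001, Ch. 9, Thm 9.3, proof] For `z ∈ M₁ ∩ M₂`: `⟪x_{2n}, z⟫ = ⟪x, z⟫`
(the computation `⟨x_{2n}, z⟩ = ⟨x_{2n−1}, P_{M₂} z⟩ = ⟨x_{2n−1}, z⟩ = ⋯`). -/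
theorem inner_altProj_eq_of_mem (x : E) {z : E} (hz₁ : z ∈ M₁) (hz₂ : z ∈ M₂) (n : ℕ) :
    ⟪altProj M₁ M₂ x n, z⟫_𝕜 = ⟪x, z⟫_𝕜 := by
  induction n with
  | zero => rfl
  | succ n ih =>
    rw [altProj_succ, Submodule.inner_starProjection_left_eq_right,
      Submodule.starProjection_eq_self_iff.2 hz₂, Submodule.inner_starProjection_left_eq_right,
      Submodule.starProjection_eq_self_iff.2 hz₁, ih]

/-- [cite: Deutsch2001, Ch. 9, Lemma 9.2] (1) ⇒ (4): if `P_{M₁}` and `P_{M₂}` commute then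
`P_{M₂} P_{M₁} = P_{M₁ ∩ M₂}`. -/
theorem starProjection_starProjection_eq_of_commute [(M₁ ⊓ M₂).HasOrthogonalProjection]
    (h : ∀ x, M₁.starProjection (M₂.starProjection x) = M₂.starProjection (M₁.starProjection x))
    (x : E) : M₂.starProjection (M₁.starProjection x) = (M₁ ⊓ M₂).starProjection x := by
  symm
  refine Submodule.eq_starProjection_of_mem_of_inner_eq_zero ?_ fun z hz => ?_
  · refine Submodule.mem_inf.2 ⟨?_, Submodule.starProjection_apply_mem _ _⟩
    rw [← h]
    exact Submodule.starProjection_apply_mem _ _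
  · obtain ⟨hz₁, hz₂⟩ := Submodule.mem_inf.1 hz
    rw [inner_sub_left, Submodule.inner_starProjection_left_eq_right,
      Submodule.starProjection_eq_self_iff.2 hz₂, Submodule.inner_starProjection_left_eq_right,
      Submodule.starProjection_eq_self_iff.2 hz₁, sub_self]

/-- [cite: Deutsch2001, Ch. 9, Lemma 9.2] In the commuting case the iteration is stationary
from the first step: `x_{2n} = P_{M₁ ∩ M₂} x` for `n ≥ 1`. -/
theorem altProj_succ_eq_of_commute [(M₁ ⊓ M₂).HasOrthogonalProjection]
    (h : ∀ x, M₁.starProjection (M₂.starProjection x) = M₂.starProjection (M₁.starProjection x))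
    (x : E) (n : ℕ) : altProj M₁ M₂ x (n + 1) = (M₁ ⊓ M₂).starProjection x := by
  induction n with
  | zero => rw [altProj_succ, altProj_zero, starProjection_starProjection_eq_of_commute h]
  | succ n ih =>
    obtain ⟨h₁, h₂⟩ := Submodule.mem_inf.1 (Submodule.starProjection_apply_mem (M₁ ⊓ M₂) x)
    rw [altProj_succ, ih, Submodule.starProjection_eq_self_iff.2 h₁,
      Submodule.starProjection_eq_self_iff.2 h₂]

/-! ## Theorem 9.3: the self-adjointness identities and the Cauchy property -/

/-- [folklore] `P_K (P_K w) = P_K w`. -/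
private theorem starProjection_idem (K : Submodule 𝕜 E) [K.HasOrthogonalProjection] (w : E) :
    K.starProjection (K.starProjection w) = K.starProjection w :=
  Submodule.starProjection_eq_self_iff.2 (Submodule.starProjection_apply_mem _ _)

/-- [cite: Deutsch2001, Ch. 9, Thm 9.3, proof, (9.3.4)] `⟨x_{2n+2}, x_{2m}⟩ = ⟨x_{2n+1}, x_{2m+1}⟩`
(for a starting point in `M₂`, so that every `x_{2m} ∈ M₂`). -/
theorem inner_altProj_succ_left {x : E} (hx : x ∈ M₂) (n m : ℕ) :
    ⟪altProj M₁ M₂ x (n + 1), altProj M₁ M₂ x m⟫_𝕜 =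
      ⟪M₁.starProjection (altProj M₁ M₂ x n), M₁.starProjection (altProj M₁ M₂ x m)⟫_𝕜 := by
  rw [altProj_succ, Submodule.inner_starProjection_left_eq_right,
    Submodule.starProjection_eq_self_iff.2 (altProj_mem_of_mem hx m),
    ← Submodule.inner_starProjection_left_eq_right M₁ (M₁.starProjection (altProj M₁ M₂ x n))
      (altProj M₁ M₂ x m), starProjection_idem M₁]

/-- [cite: Deutsch2001, Ch. 9, Thm 9.3, proof, (9.3.5)] `⟨x_{2n+1}, x_{2m+1}⟩ = ⟨x_{2n}, x_{2m+2}⟩`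
(for a starting point in `M₂`). -/
theorem inner_starProjection_altProj {x : E} (hx : x ∈ M₂) (n m : ℕ) :
    ⟪M₁.starProjection (altProj M₁ M₂ x n), M₁.starProjection (altProj M₁ M₂ x m)⟫_𝕜 =
      ⟪altProj M₁ M₂ x n, altProj M₁ M₂ x (m + 1)⟫_𝕜 := by
  rw [altProj_succ x m,
    ← Submodule.inner_starProjection_left_eq_right M₂ (altProj M₁ M₂ x n),
    Submodule.starProjection_eq_self_iff.2 (altProj_mem_of_mem hx n),
    Submodule.inner_starProjection_left_eq_right M₁ (altProj M₁ M₂ x n), starProjection_idem M₁]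

/-- [cite: Deutsch2001, Ch. 9, Thm 9.3, proof] Combining (9.3.4) and (9.3.5): one index may be
moved from the left to the right, `⟨x_{2n+2}, x_{2m}⟩ = ⟨x_{2n}, x_{2m+2}⟩`. -/
theorem inner_altProj_succ_shift {x : E} (hx : x ∈ M₂) (n m : ℕ) :
    ⟪altProj M₁ M₂ x (n + 1), altProj M₁ M₂ x m⟫_𝕜 =
      ⟪altProj M₁ M₂ x n, altProj M₁ M₂ x (m + 1)⟫_𝕜 :=
  (inner_altProj_succ_left hx n m).trans (inner_starProjection_altProj hx n m)

/-- [cite: Deutsch2001, Ch. 9, Thm 9.3, proof] `⟨x_{2n}, x_{2m}⟩ = ⟨x_{2n−2k}, x_{2m+2k}⟩`. -/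
theorem inner_altProj_add_shift {x : E} (hx : x ∈ M₂) (n m k : ℕ) :
    ⟪altProj M₁ M₂ x (n + k), altProj M₁ M₂ x m⟫_𝕜 =
      ⟪altProj M₁ M₂ x n, altProj M₁ M₂ x (m + k)⟫_𝕜 := by
  induction k generalizing n m with
  | zero => rfl
  | succ k ih =>
    rw [← add_assoc, inner_altProj_succ_shift hx, ih, ← add_assoc, Nat.add_right_comm m 1 k]

/-- [cite: Deutsch2001, Ch. 9, Thm 9.3, proof] `⟨x_{2n}, x_{2m}⟩ = ‖x_{n+m}‖²` in Deutsch's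
indexing; what is used: for `m ≤ n`, `‖x_{2n}‖² ≤ Re ⟨x_{2n}, x_{2m}⟩` (the inner product is the
squared norm of an intermediate term of the norm-decreasing alternating sequence). -/
theorem norm_altProj_sq_le_re_inner {x : E} (hx : x ∈ M₂) {m n : ℕ} (hmn : m ≤ n) :
    ‖altProj M₁ M₂ x n‖ ^ 2 ≤ RCLike.re ⟪altProj M₁ M₂ x n, altProj M₁ M₂ x m⟫_𝕜 := by
  obtain ⟨d, rfl⟩ := Nat.exists_eq_add_of_le hmn
  rcases Nat.even_or_odd' d with ⟨e, rfl | rfl⟩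
  · have h1 : m + 2 * e = m + e + e := by ring
    rw [h1, inner_altProj_add_shift hx (m + e) m e, inner_self_eq_norm_sq]
    exact pow_le_pow_left₀ (norm_nonneg _) (antitone_norm_altProj x (Nat.le_add_right _ _)) 2
  · have h1 : m + (2 * e + 1) = m + e + 1 + e := by ring
    rw [h1, inner_altProj_add_shift hx (m + e + 1) m e, inner_altProj_succ_left hx (m + e) (m + e),
      inner_self_eq_norm_sq]
    exact pow_le_pow_left₀ (norm_nonneg _)
      ((antitone_norm_altProj x (Nat.le_add_right _ _)).trans (norm_altProj_succ_le x (m + e))) 2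

/-- [cite: Deutsch2001, Ch. 9, Thm 9.3, proof] `‖x_{2n} − x_{2m}‖² ≤ ‖x_{2m}‖² − ‖x_{2n}‖²` for
`m ≤ n` (Deutsch: `= ‖x_{2n}‖² − 2‖x_{n+m}‖² + ‖x_{2m}‖²`), for a starting point in `M₂`. -/
theorem norm_altProj_sub_sq_le {x : E} (hx : x ∈ M₂) {m n : ℕ} (hmn : m ≤ n) :
    ‖altProj M₁ M₂ x n - altProj M₁ M₂ x m‖ ^ 2 ≤
      ‖altProj M₁ M₂ x m‖ ^ 2 - ‖altProj M₁ M₂ x n‖ ^ 2 := by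
  rw [norm_sub_sq (𝕜 := 𝕜)]
  linarith [norm_altProj_sq_le_re_inner (M₁ := M₁) hx hmn]

/-- [cite: Deutsch2001, Ch. 9, Thm 9.3, proof] `{x_{2n}}` is a Cauchy sequence (for a starting
point in `M₂`; no completeness needed for this step). -/
theorem cauchySeq_altProj_of_mem {x : E} (hx : x ∈ M₂) : CauchySeq (altProj M₁ M₂ x) := by
  have hanti : Antitone fun n => ‖altProj M₁ M₂ x n‖ ^ 2 := fun a b hab =>
    pow_le_pow_left₀ (norm_nonneg _) (antitone_norm_altProj x hab) 2
  have hbdd : BddBelow (range fun n => ‖altProj M₁ M₂ x n‖ ^ 2) :=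
    ⟨0, by rintro _ ⟨n, rfl⟩; positivity⟩
  have hlim := tendsto_atTop_ciInf hanti hbdd
  refine Metric.cauchySeq_iff'.2 fun ε hε => ?_
  obtain ⟨N, hN⟩ := (hlim.eventually (eventually_lt_nhds (lt_add_of_pos_right _ (pow_pos hε 2))))
    |>.exists_forall_of_atTop
  refine ⟨N, fun n hn => ?_⟩
  rw [dist_eq_norm]
  have h1 := norm_altProj_sub_sq_le (M₁ := M₁) hx hn
  have h2 : (⨅ i, ‖altProj M₁ M₂ x i‖ ^ 2) ≤ ‖altProj M₁ M₂ x n‖ ^ 2 := ciInf_le hbdd n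
  have h3 : ‖altProj M₁ M₂ x n - altProj M₁ M₂ x N‖ ^ 2 < ε ^ 2 := by linarith [hN N le_rfl]
  exact lt_of_pow_lt_pow_left₀ 2 hε.le h3

/-- [cite: Deutsch2001, Ch. 9, Thm 9.3, proof] `‖x_{2n+2} − x_{2n+1}‖² = ‖x_{2n+1}‖² − ‖x_{2n+2}‖²`
(from `⟨x_{2n+2}, x_{2n+1}⟩ = ⟨P_{M₂} x_{2n+1}, P_{M₂} x_{2n+1}⟩ = ‖x_{2n+2}‖²`). -/
theorem norm_altProj_succ_sub_sq (x : E) (n : ℕ) :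
    ‖altProj M₁ M₂ x (n + 1) - M₁.starProjection (altProj M₁ M₂ x n)‖ ^ 2 =
      ‖M₁.starProjection (altProj M₁ M₂ x n)‖ ^ 2 - ‖altProj M₁ M₂ x (n + 1)‖ ^ 2 := by
  have h : ⟪altProj M₁ M₂ x (n + 1), M₁.starProjection (altProj M₁ M₂ x n)⟫_𝕜 =
      ⟪altProj M₁ M₂ x (n + 1), altProj M₁ M₂ x (n + 1)⟫_𝕜 := by
    conv_lhs => rw [altProj_succ, ← starProjection_idem M₂,
      Submodule.inner_starProjection_left_eq_right, ← altProj_succ]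
  rw [norm_sub_sq (𝕜 := 𝕜), h, inner_self_eq_norm_sq]
  ring

/-! ## Theorem 9.3 (von Neumann) -/

/-- [cite: Deutsch2001, Ch. 9, Thm 9.3] Von Neumann's theorem for a starting point `x ∈ M₂` in
a Hilbert space: `(P_{M₂} P_{M₁})ⁿ x → P_{M₁ ∩ M₂} x`. -/
theorem tendsto_altProj_of_mem [CompleteSpace E] [(M₁ ⊓ M₂).HasOrthogonalProjection] {x : E}
    (hx : x ∈ M₂) : Tendsto (altProj M₁ M₂ x) atTop (𝓝 ((M₁ ⊓ M₂).starProjection x)) := by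
  obtain ⟨y, hy⟩ := cauchySeq_tendsto_of_complete (cauchySeq_altProj_of_mem (M₁ := M₁) hx)
  -- `y ∈ M₂` since `M₂` is closed and contains the sequence
  have hM₂ : IsClosed (M₂ : Set E) := by
    rw [← Submodule.orthogonal_orthogonal M₂]
    exact Submodule.isClosed_orthogonal _
  have hy₂ : y ∈ M₂ :=
    hM₂.mem_of_tendsto hy (Eventually.of_forall fun n => altProj_mem_of_mem hx n)
  -- the odd terms `x_{2n+1} = P_{M₁} x_{2n}` converge to `P_{M₁} y` and also to `y`
  have hv : Tendsto (fun n => M₁.starProjection (altProj M₁ M₂ x n)) atTop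
      (𝓝 (M₁.starProjection y)) :=
    (M₁.starProjection.continuous.tendsto y).comp hy
  have hu1 : Tendsto (fun n => altProj M₁ M₂ x (n + 1)) atTop (𝓝 y) :=
    (tendsto_add_atTop_iff_nat 1).2 hy
  have hnv : Tendsto (fun n => ‖M₁.starProjection (altProj M₁ M₂ x n)‖) atTop (𝓝 ‖y‖) :=
    tendsto_of_tendsto_of_tendsto_of_le_of_le hu1.norm hy.norm
      (fun n => norm_altProj_succ_le x n) (fun n => norm_starProjection_altProj_le x n)
  have hdiff : Tendsto (fun n => altProj M₁ M₂ x (n + 1) - M₁.starProjection (altProj M₁ M₂ x n))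
      atTop (𝓝 0) := by
    rw [tendsto_zero_iff_norm_tendsto_zero]
    have h0 : Tendsto (fun n => ‖M₁.starProjection (altProj M₁ M₂ x n)‖ ^ 2 -
        ‖altProj M₁ M₂ x (n + 1)‖ ^ 2) atTop (𝓝 0) := by
      have := (hnv.pow 2).sub (hu1.norm.pow 2)
      rwa [sub_self] at this
    have h1 : Tendsto (fun n => √(‖M₁.starProjection (altProj M₁ M₂ x n)‖ ^ 2 -
        ‖altProj M₁ M₂ x (n + 1)‖ ^ 2)) atTop (𝓝 0) := by
      simpa using h0.sqrt
    refine h1.congr fun n => ?_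
    rw [← norm_altProj_succ_sub_sq, Real.sqrt_sq (norm_nonneg _)]
  have hv' : Tendsto (fun n => M₁.starProjection (altProj M₁ M₂ x n)) atTop (𝓝 y) := by
    have := hu1.sub hdiff
    rw [sub_zero] at this
    exact this.congr fun n => sub_sub_cancel _ _
  have hy₁ : y ∈ M₁ := Submodule.starProjection_eq_self_iff.1 (tendsto_nhds_unique hv hv')
  -- identification of the limit
  have hP : (M₁ ⊓ M₂).starProjection x = y := by
    refine Submodule.eq_starProjection_of_mem_of_inner_eq_zero (Submodule.mem_inf.2 ⟨hy₁, hy₂⟩)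
      fun z hz => ?_
    obtain ⟨hz₁, hz₂⟩ := Submodule.mem_inf.1 hz
    have hlim : Tendsto (fun n => ⟪altProj M₁ M₂ x n, z⟫_𝕜) atTop (𝓝 ⟪y, z⟫_𝕜) :=
      Filter.Tendsto.inner (𝕜 := 𝕜) hy tendsto_const_nhds
    have hconst : (fun n => ⟪altProj M₁ M₂ x n, z⟫_𝕜) = fun _ => ⟪x, z⟫_𝕜 :=
      funext fun n => inner_altProj_eq_of_mem x hz₁ hz₂ n
    rw [hconst] at hlim
    rw [inner_sub_left, tendsto_nhds_unique tendsto_const_nhds hlim, sub_self]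
  rwa [hP]

/-- [cite: Deutsch2001, Ch. 9, Thm 9.3] **Von Neumann's alternating projections theorem.**
Let `M₁`, `M₂` be closed subspaces of a Hilbert space (more generally, subspaces admitting
orthogonal projections, together with `M₁ ∩ M₂`).  Then for every `x`,
`(P_{M₂} P_{M₁})ⁿ x → P_{M₁ ∩ M₂} x`. -/
theorem tendsto_altProj [CompleteSpace E] [(M₁ ⊓ M₂).HasOrthogonalProjection] (x : E) :
    Tendsto (altProj M₁ M₂ x) atTop (𝓝 ((M₁ ⊓ M₂).starProjection x)) := by
  have h1 := tendsto_altProj_of_mem (M₁ := M₁) (altProj_succ_mem (M₁ := M₁) (M₂ := M₂) x 0)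
  have hP : (M₁ ⊓ M₂).starProjection (altProj M₁ M₂ x 1) = (M₁ ⊓ M₂).starProjection x := by
    refine Submodule.eq_starProjection_of_mem_of_inner_eq_zero
      (Submodule.starProjection_apply_mem _ _) fun z hz => ?_
    obtain ⟨hz₁, hz₂⟩ := Submodule.mem_inf.1 hz
    rw [inner_sub_left, inner_altProj_eq_of_mem x hz₁ hz₂ 1, ← inner_sub_left]
    exact Submodule.starProjection_inner_eq_zero x z hz
  rw [hP] at h1
  exact (tendsto_add_atTop_iff_nat 1).1 (h1.congr fun n => altProj_altProj_one x n)

/-- [cite: Deutsch2001, Ch. 9, Thm 9.3] Operator-power form: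
`lim_n (P_{M₂} P_{M₁})ⁿ (x) = P_{M₁ ∩ M₂}(x)` for every `x`. -/
theorem tendsto_pow_starProjection_comp_apply [CompleteSpace E]
    [(M₁ ⊓ M₂).HasOrthogonalProjection] (x : E) :
    Tendsto (fun n => ((M₂.starProjection.comp M₁.starProjection) ^ n) x) atTop
      (𝓝 ((M₁ ⊓ M₂).starProjection x)) :=
  (tendsto_altProj x).congr fun n => altProj_eq_pow_apply x n

/-- [cite: Deutsch2001, Ch. 9, Thm 9.3] The odd-indexed terms converge to the same limit:
`P_{M₁} (P_{M₂} P_{M₁})ⁿ x → P_{M₁ ∩ M₂} x`; hence the whole alternating sequence (9.3.1)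
converges to `P_{M₁ ∩ M₂} x`. -/
theorem tendsto_starProjection_altProj [CompleteSpace E] [(M₁ ⊓ M₂).HasOrthogonalProjection]
    (x : E) : Tendsto (fun n => M₁.starProjection (altProj M₁ M₂ x n)) atTop
      (𝓝 ((M₁ ⊓ M₂).starProjection x)) := by
  have h := ((M₁.starProjection.continuous.tendsto _).comp (tendsto_altProj (M₁ := M₁)
    (M₂ := M₂) x))
  rwa [Submodule.starProjection_eq_self_iff.2
    (Submodule.mem_inf.1 (Submodule.starProjection_apply_mem (M₁ ⊓ M₂) x)).1] at h

/-- [cite: Deutsch2001, Ch. 9, Thm 9.3, proof] A-posteriori error bound for a starting point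
`x ∈ M₂`: `‖P_{M₁∩M₂} x − x_{2m}‖² ≤ ‖x_{2m}‖² − ‖P_{M₁∩M₂} x‖²` (let `n → ∞` in
`‖x_{2n} − x_{2m}‖² ≤ ‖x_{2m}‖² − ‖x_{2n}‖²`). -/
theorem norm_starProjection_sub_altProj_sq_le [CompleteSpace E]
    [(M₁ ⊓ M₂).HasOrthogonalProjection] {x : E} (hx : x ∈ M₂) (m : ℕ) :
    ‖(M₁ ⊓ M₂).starProjection x - altProj M₁ M₂ x m‖ ^ 2 ≤
      ‖altProj M₁ M₂ x m‖ ^ 2 - ‖(M₁ ⊓ M₂).starProjection x‖ ^ 2 := by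
  have h := tendsto_altProj_of_mem (M₁ := M₁) hx
  have h1 : Tendsto (fun n => ‖altProj M₁ M₂ x n - altProj M₁ M₂ x m‖ ^ 2) atTop
      (𝓝 (‖(M₁ ⊓ M₂).starProjection x - altProj M₁ M₂ x m‖ ^ 2)) :=
    ((h.sub tendsto_const_nhds).norm).pow 2
  have h2 : Tendsto (fun n => ‖altProj M₁ M₂ x m‖ ^ 2 - ‖altProj M₁ M₂ x n‖ ^ 2) atTop
      (𝓝 (‖altProj M₁ M₂ x m‖ ^ 2 - ‖(M₁ ⊓ M₂).starProjection x‖ ^ 2)) :=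
    tendsto_const_nhds.sub (h.norm.pow 2)
  exact le_of_tendsto_of_tendsto h1 h2 (eventually_atTop.2 ⟨m, fun n hn =>
    norm_altProj_sub_sq_le hx hn⟩)

/-- [cite: Deutsch2001, Ch. 9, Thm 9.3, Remark (1)] In a Hilbert space, closed subspaces `M₁`,
`M₂` have a closed, hence complete, intersection, which therefore admits an orthogonal
projection (how to discharge the instance hypothesis `(M₁ ⊓ M₂).HasOrthogonalProjection`). -/
theorem hasOrthogonalProjection_inf [CompleteSpace E] {M₁ M₂ : Submodule 𝕜 E}
    (h₁ : IsClosed (M₁ : Set E)) (h₂ : IsClosed (M₂ : Set E)) :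
    (M₁ ⊓ M₂).HasOrthogonalProjection := by
  have h : IsClosed ((M₁ ⊓ M₂ : Submodule 𝕜 E) : Set E) := by
    rw [Submodule.coe_inf]
    exact h₁.inter h₂
  haveI : CompleteSpace (M₁ ⊓ M₂ : Submodule 𝕜 E) := h.completeSpace_coe
  exact Submodule.HasOrthogonalProjection.ofCompleteSpace _

/-- [cite: Deutsch2001, Ch. 9, Thm 9.3, Remark (1)] Likewise a closed subspace of a Hilbert
space admits an orthogonal projection. -/
theorem hasOrthogonalProjection_of_isClosed [CompleteSpace E] {M : Submodule 𝕜 E}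
    (h : IsClosed (M : Set E)) : M.HasOrthogonalProjection := by
  haveI : CompleteSpace M := h.completeSpace_coe
  exact Submodule.HasOrthogonalProjection.ofCompleteSpace _

/-! ## Definition 9.4 / Lemma 9.5: the angle between two subspaces -/

/-- [folklore] The set in Definition 9.4 is bounded above by `1` (Schwarz). -/
private theorem cosAngle_set_bddAbove (M₁ M₂ : Submodule 𝕜 E) :
    BddAbove ((fun p : E × E => ‖⟪p.1, p.2⟫_𝕜‖) ''
      {p : E × E | p.1 ∈ M₁ ∧ p.1 ∈ (M₁ ⊓ M₂)ᗮ ∧ ‖p.1‖ ≤ 1 ∧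
        p.2 ∈ M₂ ∧ p.2 ∈ (M₁ ⊓ M₂)ᗮ ∧ ‖p.2‖ ≤ 1}) := by
  refine ⟨1, ?_⟩
  rintro _ ⟨p, ⟨-, -, hp1, -, -, hp2⟩, rfl⟩
  calc ‖⟪p.1, p.2⟫_𝕜‖ ≤ ‖p.1‖ * ‖p.2‖ := norm_inner_le_norm _ _
    _ ≤ 1 * 1 := mul_le_mul hp1 hp2 (norm_nonneg _) zero_le_one
    _ = 1 := one_mul 1

/-- [folklore] The set in Definition 9.4 contains `0 = ‖⟪0, 0⟫‖`. -/
private theorem zero_mem_cosAngle_set (M₁ M₂ : Submodule 𝕜 E) :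
    (0 : ℝ) ∈ (fun p : E × E => ‖⟪p.1, p.2⟫_𝕜‖) ''
      {p : E × E | p.1 ∈ M₁ ∧ p.1 ∈ (M₁ ⊓ M₂)ᗮ ∧ ‖p.1‖ ≤ 1 ∧
        p.2 ∈ M₂ ∧ p.2 ∈ (M₁ ⊓ M₂)ᗮ ∧ ‖p.2‖ ≤ 1} :=
  ⟨(0, 0), ⟨zero_mem _, zero_mem _, by simp, zero_mem _, zero_mem _, by simp⟩, by simp⟩

/-- [cite: Deutsch2001, Ch. 9, Lemma 9.5 (1)] `0 ≤ c(M₁, M₂)`. -/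
theorem cosAngle_nonneg (M₁ M₂ : Submodule 𝕜 E) : 0 ≤ cosAngle M₁ M₂ :=
  le_csSup (cosAngle_set_bddAbove M₁ M₂) (zero_mem_cosAngle_set M₁ M₂)

/-- [cite: Deutsch2001, Ch. 9, Lemma 9.5 (1)] `c(M₁, M₂) ≤ 1`. -/
theorem cosAngle_le_one (M₁ M₂ : Submodule 𝕜 E) : cosAngle M₁ M₂ ≤ 1 := by
  refine csSup_le ⟨0, zero_mem_cosAngle_set M₁ M₂⟩ ?_
  rintro _ ⟨p, ⟨-, -, hp1, -, -, hp2⟩, rfl⟩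
  calc ‖⟪p.1, p.2⟫_𝕜‖ ≤ ‖p.1‖ * ‖p.2‖ := norm_inner_le_norm _ _
    _ ≤ 1 * 1 := mul_le_mul hp1 hp2 (norm_nonneg _) zero_le_one
    _ = 1 := one_mul 1

/-- [cite: Deutsch2001, Ch. 9, Lemma 9.5 (6)] `‖⟪x, y⟫‖ ≤ c(M₁, M₂) ‖x‖ ‖y‖` for
`x ∈ M₁ ∩ (M₁∩M₂)ᗮ` and `y ∈ M₂ ∩ (M₁∩M₂)ᗮ` (immediate from Definition 9.4 by normalising). -/
theorem norm_inner_le_cosAngle_mul {M₁ M₂ : Submodule 𝕜 E} {x y : E} (hx₁ : x ∈ M₁)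
    (hx : x ∈ (M₁ ⊓ M₂)ᗮ) (hy₂ : y ∈ M₂) (hy : y ∈ (M₁ ⊓ M₂)ᗮ) :
    ‖⟪x, y⟫_𝕜‖ ≤ cosAngle M₁ M₂ * ‖x‖ * ‖y‖ := by
  by_cases hx0 : x = 0
  · simp [hx0]
  by_cases hy0 : y = 0
  · simp [hy0]
  have hxn : 0 < ‖x‖ := norm_pos_iff.2 hx0
  have hyn : 0 < ‖y‖ := norm_pos_iff.2 hy0
  set a : E := ((‖x‖⁻¹ : ℝ) : 𝕜) • x with ha
  set b : E := ((‖y‖⁻¹ : ℝ) : 𝕜) • y with hb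
  have han : ‖a‖ ≤ 1 := by
    rw [ha, norm_smul, RCLike.norm_ofReal, abs_of_pos (inv_pos.2 hxn), inv_mul_cancel₀ hxn.ne']
  have hbn : ‖b‖ ≤ 1 := by
    rw [hb, norm_smul, RCLike.norm_ofReal, abs_of_pos (inv_pos.2 hyn), inv_mul_cancel₀ hyn.ne']
  have hmem : ‖⟪a, b⟫_𝕜‖ ∈ (fun p : E × E => ‖⟪p.1, p.2⟫_𝕜‖) ''
      {p : E × E | p.1 ∈ M₁ ∧ p.1 ∈ (M₁ ⊓ M₂)ᗮ ∧ ‖p.1‖ ≤ 1 ∧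
        p.2 ∈ M₂ ∧ p.2 ∈ (M₁ ⊓ M₂)ᗮ ∧ ‖p.2‖ ≤ 1} :=
    ⟨(a, b), ⟨M₁.smul_mem _ hx₁, Submodule.smul_mem _ _ hx, han, M₂.smul_mem _ hy₂,
      Submodule.smul_mem _ _ hy, hbn⟩, rfl⟩
  have hle : ‖⟪a, b⟫_𝕜‖ ≤ cosAngle M₁ M₂ := le_csSup (cosAngle_set_bddAbove M₁ M₂) hmem
  have hab : ‖⟪a, b⟫_𝕜‖ = ‖x‖⁻¹ * (‖y‖⁻¹ * ‖⟪x, y⟫_𝕜‖) := by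
    rw [ha, hb, inner_smul_real_left, inner_smul_real_right, norm_smul, norm_smul,
      Real.norm_of_nonneg (inv_pos.2 hxn).le, Real.norm_of_nonneg (inv_pos.2 hyn).le]
  rw [hab, inv_mul_le_iff₀ hxn, inv_mul_le_iff₀ hyn] at hle
  calc ‖⟪x, y⟫_𝕜‖ ≤ ‖y‖ * (‖x‖ * cosAngle M₁ M₂) := hle
    _ = cosAngle M₁ M₂ * ‖x‖ * ‖y‖ := by ring

/-- [cite: Deutsch2001, Ch. 9, Lemma 9.5 (6)] `‖⟪x, y⟫‖ ≤ c(M₁, M₂) ‖x‖ ‖y‖` for `x ∈ M₁` and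
`y ∈ M₂ ∩ (M₁∩M₂)ᗮ` (decompose `x = P_{M₁∩M₂} x + (x − P_{M₁∩M₂} x)`, Lemma 9.5 (4)/(5)). -/
theorem norm_inner_le_cosAngle_mul_of_right_mem {M₁ M₂ : Submodule 𝕜 E}
    [(M₁ ⊓ M₂).HasOrthogonalProjection] {x y : E} (hx₁ : x ∈ M₁) (hy₂ : y ∈ M₂)
    (hy : y ∈ (M₁ ⊓ M₂)ᗮ) : ‖⟪x, y⟫_𝕜‖ ≤ cosAngle M₁ M₂ * ‖x‖ * ‖y‖ := by
  set x₂ : E := x - (M₁ ⊓ M₂).starProjection x with hx₂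
  have hx₂M₁ : x₂ ∈ M₁ :=
    M₁.sub_mem hx₁ (Submodule.mem_inf.1 (Submodule.starProjection_apply_mem (M₁ ⊓ M₂) x)).1
  have hx₂o : x₂ ∈ (M₁ ⊓ M₂)ᗮ := Submodule.sub_starProjection_mem_orthogonal x
  have hinner : ⟪x, y⟫_𝕜 = ⟪x₂, y⟫_𝕜 := by
    rw [hx₂, inner_sub_left, Submodule.inner_right_of_mem_orthogonal
      (Submodule.starProjection_apply_mem (M₁ ⊓ M₂) x) hy, sub_zero]
  have hnorm : ‖x₂‖ ≤ ‖x‖ := by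
    have h := Submodule.norm_sq_eq_add_norm_sq_starProjection x (M₁ ⊓ M₂)
    rw [Submodule.starProjection_orthogonal_val] at h
    nlinarith [norm_nonneg x, norm_nonneg x₂, norm_nonneg ((M₁ ⊓ M₂).starProjection x)]
  rw [hinner]
  calc ‖⟪x₂, y⟫_𝕜‖ ≤ cosAngle M₁ M₂ * ‖x₂‖ * ‖y‖ := norm_inner_le_cosAngle_mul hx₂M₁ hx₂o hy₂ hy
    _ ≤ cosAngle M₁ M₂ * ‖x‖ * ‖y‖ := by
      gcongr
      exact cosAngle_nonneg M₁ M₂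

/-- [cite: Deutsch2001, Ch. 9, Lemma 9.5 (6)] `‖⟪x, y⟫‖ ≤ c(M₁, M₂) ‖x‖ ‖y‖` for
`x ∈ M₁ ∩ (M₁∩M₂)ᗮ` and `y ∈ M₂`. -/
theorem norm_inner_le_cosAngle_mul_of_left_mem {M₁ M₂ : Submodule 𝕜 E}
    [(M₁ ⊓ M₂).HasOrthogonalProjection] {x y : E} (hx₁ : x ∈ M₁) (hx : x ∈ (M₁ ⊓ M₂)ᗮ)
    (hy₂ : y ∈ M₂) : ‖⟪x, y⟫_𝕜‖ ≤ cosAngle M₁ M₂ * ‖x‖ * ‖y‖ := by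
  set y₂ : E := y - (M₁ ⊓ M₂).starProjection y with hy₂'
  have hy₂M₂ : y₂ ∈ M₂ :=
    M₂.sub_mem hy₂ (Submodule.mem_inf.1 (Submodule.starProjection_apply_mem (M₁ ⊓ M₂) y)).2
  have hy₂o : y₂ ∈ (M₁ ⊓ M₂)ᗮ := Submodule.sub_starProjection_mem_orthogonal y
  have hinner : ⟪x, y⟫_𝕜 = ⟪x, y₂⟫_𝕜 := by
    rw [hy₂', inner_sub_right, Submodule.inner_left_of_mem_orthogonal
      (Submodule.starProjection_apply_mem (M₁ ⊓ M₂) y) hx, sub_zero]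
  have hnorm : ‖y₂‖ ≤ ‖y‖ := by
    have h := Submodule.norm_sq_eq_add_norm_sq_starProjection y (M₁ ⊓ M₂)
    rw [Submodule.starProjection_orthogonal_val] at h
    nlinarith [norm_nonneg y, norm_nonneg y₂, norm_nonneg ((M₁ ⊓ M₂).starProjection y)]
  rw [hinner]
  calc ‖⟪x, y₂⟫_𝕜‖ ≤ cosAngle M₁ M₂ * ‖x‖ * ‖y₂‖ := norm_inner_le_cosAngle_mul hx₁ hx hy₂M₂ hy₂o
    _ ≤ cosAngle M₁ M₂ * ‖x‖ * ‖y‖ := by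
      gcongr
      exact mul_nonneg (cosAngle_nonneg M₁ M₂) (norm_nonneg _)

/-! ## Theorem 9.8: rate of convergence -/

omit [M₂.HasOrthogonalProjection] in
/-- [cite: Deutsch2001, Ch. 9, Thm 9.8, proof, (9.8.2)] `P_{M₁}((M₁∩M₂)ᗮ) ⊆ (M₁∩M₂)ᗮ`. -/
theorem starProjection_mem_orthogonal_inf_left {w : E} (hw : w ∈ (M₁ ⊓ M₂)ᗮ) :
    M₁.starProjection w ∈ (M₁ ⊓ M₂)ᗮ := by
  refine (Submodule.mem_orthogonal _ _).2 fun z hz => ?_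
  rw [← Submodule.inner_starProjection_left_eq_right,
    Submodule.starProjection_eq_self_iff.2 (Submodule.mem_inf.1 hz).1]
  exact (Submodule.mem_orthogonal _ _).1 hw z hz

omit [M₁.HasOrthogonalProjection] in
/-- [cite: Deutsch2001, Ch. 9, Thm 9.8, proof, (9.8.2)] `P_{M₂}((M₁∩M₂)ᗮ) ⊆ (M₁∩M₂)ᗮ`. -/
theorem starProjection_mem_orthogonal_inf_right {w : E} (hw : w ∈ (M₁ ⊓ M₂)ᗮ) :
    M₂.starProjection w ∈ (M₁ ⊓ M₂)ᗮ := by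
  refine (Submodule.mem_orthogonal _ _).2 fun z hz => ?_
  rw [← Submodule.inner_starProjection_left_eq_right,
    Submodule.starProjection_eq_self_iff.2 (Submodule.mem_inf.1 hz).2]
  exact (Submodule.mem_orthogonal _ _).1 hw z hz

/-- [cite: Deutsch2001, Ch. 9, Thm 9.8, proof, (9.8.3)] `P((M₁∩M₂)ᗮ) ⊆ (M₁∩M₂)ᗮ` for
`P = P_{M₂} P_{M₁}`, and hence for all its iterates. -/
theorem altProj_mem_orthogonal_inf {w : E} (hw : w ∈ (M₁ ⊓ M₂)ᗮ) (n : ℕ) :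
    altProj M₁ M₂ w n ∈ (M₁ ⊓ M₂)ᗮ := by
  induction n with
  | zero => exact hw
  | succ n ih =>
    rw [altProj_succ]
    exact starProjection_mem_orthogonal_inf_right (starProjection_mem_orthogonal_inf_left ih)

/-- [cite: Deutsch2001, Ch. 9, Thm 9.8, proof, (9.8.4)] `‖P_{M₂} P_{M₁} x‖ ≤ c ‖P_{M₁} x‖` for
`x ∈ (M₁∩M₂)ᗮ` (from `‖Px‖² = ⟨P_{M₁} x, Px⟩ ≤ c ‖P_{M₁} x‖ ‖Px‖`, Lemma 9.5 (6)). -/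
theorem norm_altProj_one_le {w : E} (hw : w ∈ (M₁ ⊓ M₂)ᗮ) :
    ‖altProj M₁ M₂ w 1‖ ≤ cosAngle M₁ M₂ * ‖M₁.starProjection w‖ := by
  set a : E := M₁.starProjection w with ha
  have hb : altProj M₁ M₂ w 1 = M₂.starProjection a := by rw [altProj_succ, altProj_zero]
  set b : E := altProj M₁ M₂ w 1 with hb'
  have haM : a ∈ (M₁ ⊓ M₂)ᗮ := starProjection_mem_orthogonal_inf_left hw
  have hbM : b ∈ (M₁ ⊓ M₂)ᗮ := altProj_mem_orthogonal_inf hw 1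
  have hsq : ‖b‖ ^ 2 = RCLike.re ⟪a, b⟫_𝕜 := by
    have h1 : ⟪a, b⟫_𝕜 = ⟪b, b⟫_𝕜 := by
      have h2 : ⟪a - M₂.starProjection a, M₂.starProjection a⟫_𝕜 = 0 :=
        Submodule.inner_left_of_mem_orthogonal (Submodule.starProjection_apply_mem _ _)
          (Submodule.sub_starProjection_mem_orthogonal a)
      rw [inner_sub_left, sub_eq_zero] at h2
      rw [hb, h2]
    rw [h1, inner_self_eq_norm_sq]
  have hle : ‖b‖ ^ 2 ≤ cosAngle M₁ M₂ * ‖a‖ * ‖b‖ :=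
    hsq.le.trans ((RCLike.re_le_norm _).trans (norm_inner_le_cosAngle_mul
      (Submodule.starProjection_apply_mem _ _) haM
      (hb ▸ Submodule.starProjection_apply_mem _ _) hbM))
  by_cases hb0 : ‖b‖ = 0
  · rw [hb0]
    exact mul_nonneg (cosAngle_nonneg M₁ M₂) (norm_nonneg _)
  · have hbpos : 0 < ‖b‖ := lt_of_le_of_ne (norm_nonneg _) (Ne.symm hb0)
    rw [pow_two] at hle
    exact le_of_mul_le_mul_right hle hbpos

/-- [cite: Deutsch2001, Ch. 9, Thm 9.8, proof, (9.8.4)] Consequently `‖P x‖ ≤ c ‖x‖` on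
`(M₁∩M₂)ᗮ`. -/
theorem norm_altProj_one_le' {w : E} (hw : w ∈ (M₁ ⊓ M₂)ᗮ) :
    ‖altProj M₁ M₂ w 1‖ ≤ cosAngle M₁ M₂ * ‖w‖ :=
  (norm_altProj_one_le hw).trans (mul_le_mul_of_nonneg_left
    (M₁.norm_starProjection_apply_le _) (cosAngle_nonneg M₁ M₂))

omit [M₂.HasOrthogonalProjection] in
/-- [cite: Deutsch2001, Ch. 9, Thm 9.8, proof, (9.8.5)] `‖P_{M₁} x‖ ≤ c ‖x‖` for
`x ∈ M₂ ∩ (M₁∩M₂)ᗮ` (from `‖P_{M₁} x‖² = ⟨x, P_{M₁} x⟩ ≤ c ‖x‖ ‖P_{M₁} x‖`). -/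
theorem norm_starProjection_le_of_mem {v : E} (hv₂ : v ∈ M₂) (hv : v ∈ (M₁ ⊓ M₂)ᗮ) :
    ‖M₁.starProjection v‖ ≤ cosAngle M₁ M₂ * ‖v‖ := by
  set a : E := M₁.starProjection v with ha
  have haM : a ∈ (M₁ ⊓ M₂)ᗮ := starProjection_mem_orthogonal_inf_left hv
  have hsq : ‖a‖ ^ 2 = RCLike.re ⟪a, v⟫_𝕜 := by
    have h1 : ⟪a, v⟫_𝕜 = ⟪a, a⟫_𝕜 := by
      rw [ha, ← Submodule.inner_starProjection_left_eq_right M₁ (M₁.starProjection v) v,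
        starProjection_idem M₁ v]
    rw [h1, inner_self_eq_norm_sq]
  have hle : ‖a‖ ^ 2 ≤ cosAngle M₁ M₂ * ‖a‖ * ‖v‖ :=
    hsq.le.trans ((RCLike.re_le_norm _).trans (norm_inner_le_cosAngle_mul
      (Submodule.starProjection_apply_mem _ _) haM hv₂ hv))
  by_cases ha0 : ‖a‖ = 0
  · rw [ha0]
    exact mul_nonneg (cosAngle_nonneg M₁ M₂) (norm_nonneg _)
  · have hapos : 0 < ‖a‖ := lt_of_le_of_ne (norm_nonneg _) (Ne.symm ha0)
    rw [pow_two, mul_right_comm] at hle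
    exact le_of_mul_le_mul_right hle hapos

/-- [cite: Deutsch2001, Ch. 9, Thm 9.8, proof, (9.8.5)] `‖P x‖ ≤ c² ‖x‖` for all
`x ∈ M₂ ∩ (M₁∩M₂)ᗮ`, in particular for all `x ∈ P((M₁∩M₂)ᗮ)`. -/
theorem norm_altProj_one_le_sq_mul {v : E} (hv₂ : v ∈ M₂) (hv : v ∈ (M₁ ⊓ M₂)ᗮ) :
    ‖altProj M₁ M₂ v 1‖ ≤ cosAngle M₁ M₂ ^ 2 * ‖v‖ :=
  calc ‖altProj M₁ M₂ v 1‖ ≤ cosAngle M₁ M₂ * ‖M₁.starProjection v‖ := norm_altProj_one_le hv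
    _ ≤ cosAngle M₁ M₂ * (cosAngle M₁ M₂ * ‖v‖) :=
      mul_le_mul_of_nonneg_left (norm_starProjection_le_of_mem hv₂ hv) (cosAngle_nonneg M₁ M₂)
    _ = cosAngle M₁ M₂ ^ 2 * ‖v‖ := by ring

/-- [cite: Deutsch2001, Ch. 9, Thm 9.8, proof] Induction on (9.8.5): `‖Pⁿ x‖ ≤ c^{2n} ‖x‖` for
`x ∈ M₂ ∩ (M₁∩M₂)ᗮ`. -/
theorem norm_altProj_le_pow_mul_of_mem {v : E} (hv₂ : v ∈ M₂) (hv : v ∈ (M₁ ⊓ M₂)ᗮ) (n : ℕ) :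
    ‖altProj M₁ M₂ v n‖ ≤ cosAngle M₁ M₂ ^ (2 * n) * ‖v‖ := by
  induction n with
  | zero => simp [altProj_zero]
  | succ n ih =>
    have h1 : altProj M₁ M₂ v (n + 1) = altProj M₁ M₂ (altProj M₁ M₂ v n) 1 := by
      rw [altProj_succ, altProj_succ, altProj_zero]
    calc ‖altProj M₁ M₂ v (n + 1)‖ = ‖altProj M₁ M₂ (altProj M₁ M₂ v n) 1‖ := by rw [h1]
      _ ≤ cosAngle M₁ M₂ ^ 2 * ‖altProj M₁ M₂ v n‖ :=
        norm_altProj_one_le_sq_mul (altProj_mem_of_mem hv₂ n) (altProj_mem_orthogonal_inf hv n)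
      _ ≤ cosAngle M₁ M₂ ^ 2 * (cosAngle M₁ M₂ ^ (2 * n) * ‖v‖) :=
        mul_le_mul_of_nonneg_left ih (pow_nonneg (cosAngle_nonneg M₁ M₂) 2)
      _ = cosAngle M₁ M₂ ^ (2 * (n + 1)) * ‖v‖ := by ring

/-- [cite: Deutsch2001, Ch. 9, Thm 9.8, proof] `‖Pⁿ⁺¹ x‖ ≤ c^{2n+1} ‖x‖` for
`x ∈ (M₁∩M₂)ᗮ` (`‖Pⁿ⁻¹(P x)‖ ≤ c^{2(n−1)} ‖P x‖ ≤ c^{2(n−1)} c ‖x‖`). -/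
theorem norm_altProj_succ_le_pow_mul {w : E} (hw : w ∈ (M₁ ⊓ M₂)ᗮ) (n : ℕ) :
    ‖altProj M₁ M₂ w (n + 1)‖ ≤ cosAngle M₁ M₂ ^ (2 * n + 1) * ‖w‖ :=
  calc ‖altProj M₁ M₂ w (n + 1)‖ = ‖altProj M₁ M₂ (altProj M₁ M₂ w 1) n‖ := by
        rw [altProj_altProj_one]
    _ ≤ cosAngle M₁ M₂ ^ (2 * n) * ‖altProj M₁ M₂ w 1‖ :=
      norm_altProj_le_pow_mul_of_mem (altProj_succ_mem w 0) (altProj_mem_orthogonal_inf hw 1) n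
    _ ≤ cosAngle M₁ M₂ ^ (2 * n) * (cosAngle M₁ M₂ * ‖w‖) :=
      mul_le_mul_of_nonneg_left (norm_altProj_one_le' hw) (pow_nonneg (cosAngle_nonneg M₁ M₂) _)
    _ = cosAngle M₁ M₂ ^ (2 * n + 1) * ‖w‖ := by ring

/-- [cite: Deutsch2001, Ch. 9, Thm 9.8] **Rate of convergence (Aronszajn).**  For each `x` and
`n ≥ 1` (written `n + 1`),
`‖(P_{M₂} P_{M₁})ⁿ⁺¹ x − P_{M₁∩M₂} x‖ ≤ c^{2n+1} ‖x − P_{M₁∩M₂} x‖`, `c = c(M₁, M₂)`. -/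
theorem norm_altProj_sub_starProjection_le [(M₁ ⊓ M₂).HasOrthogonalProjection] (x : E)
    (n : ℕ) : ‖altProj M₁ M₂ x (n + 1) - (M₁ ⊓ M₂).starProjection x‖ ≤
      cosAngle M₁ M₂ ^ (2 * n + 1) * ‖x - (M₁ ⊓ M₂).starProjection x‖ := by
  obtain ⟨h₁, h₂⟩ := Submodule.mem_inf.1 (Submodule.starProjection_apply_mem (M₁ ⊓ M₂) x)
  have h : altProj M₁ M₂ x (n + 1) - (M₁ ⊓ M₂).starProjection x =
      altProj M₁ M₂ (x - (M₁ ⊓ M₂).starProjection x) (n + 1) := by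
    rw [altProj_sub, altProj_eq_self_of_mem h₁ h₂]
  rw [h]
  exact norm_altProj_succ_le_pow_mul (Submodule.sub_starProjection_mem_orthogonal x) n

/-- [cite: Deutsch2001, Ch. 9, Thm 9.8] The second inequality of Theorem 9.8:
`‖(P_{M₂} P_{M₁})ⁿ⁺¹ x − P_{M₁∩M₂} x‖ ≤ c^{2n+1} ‖x‖`. -/
theorem norm_altProj_sub_starProjection_le' [(M₁ ⊓ M₂).HasOrthogonalProjection] (x : E)
    (n : ℕ) : ‖altProj M₁ M₂ x (n + 1) - (M₁ ⊓ M₂).starProjection x‖ ≤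
      cosAngle M₁ M₂ ^ (2 * n + 1) * ‖x‖ := by
  refine (norm_altProj_sub_starProjection_le x n).trans
    (mul_le_mul_of_nonneg_left ?_ (pow_nonneg (cosAngle_nonneg M₁ M₂) _))
  have h := Submodule.norm_sq_eq_add_norm_sq_starProjection x (M₁ ⊓ M₂)
  rw [Submodule.starProjection_orthogonal_val] at h
  nlinarith [norm_nonneg x, norm_nonneg (x - (M₁ ⊓ M₂).starProjection x),
    norm_nonneg ((M₁ ⊓ M₂).starProjection x)]

/-- [cite: Deutsch2001, Ch. 9, Thm 9.8] Operator-power form of the rate: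
`‖(P_{M₂} P_{M₁})ⁿ⁺¹ (x) − P_{M₁∩M₂}(x)‖ ≤ c^{2n+1} ‖x‖`. -/
theorem norm_pow_starProjection_comp_apply_sub_le [(M₁ ⊓ M₂).HasOrthogonalProjection] (x : E)
    (n : ℕ) : ‖((M₂.starProjection.comp M₁.starProjection) ^ (n + 1)) x -
      (M₁ ⊓ M₂).starProjection x‖ ≤ cosAngle M₁ M₂ ^ (2 * n + 1) * ‖x‖ := by
  rw [← altProj_eq_pow_apply]
  exact norm_altProj_sub_starProjection_le' x n

end Literature.Analysis.Convex.AlternatingProjections
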